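import Summits.HodgeConjecture.HodgeConjecture.Theorems.K2E3BranchBCasselmanPairConstants   -- ★ Z3 (K2E3-p26 (g0)): the frame + `integral_toFun_weyl_mul_eq ∕ integral_toFun_conj_eq` whose `hS ∕ hfin` binders this file discharges; brings ★ Z3-a CM dress (`exists_coe_eA_eq_upper`, `mem_iff_v_le_one`, `conj_mem_iff_v_lt_one`), ★ place model (`v_lt_one_of_rel`), ★ CM letters (`isClosed_N`)
import Summits.HodgeConjecture.HodgeConjecture.Theorems.F0P3cStCharTSStLevelsTransport        -- ★ (G6)-ST FILE C: `coe_eA_apply`, `mem_K0_iff_mem_integralLevel` (`K0 = K_v`), `I_le_K0`, `isOpen_isCompact_levels`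
import Literature.NumberTheory.Automorphic.HeisenbergStrataMeasureUnramifiedAll                 -- ★ (P-L)-dy FILE L2b (LH7-p04 (g13)): `measureReal_rankStratum_zero_anyChar` (`μ_N(S₀) = q⁻³ μ_N(N ∩ K₃)`, every Haar `μ_N`, `v` unramified)
import Literature.NumberTheory.Automorphic.ValuedFieldValuativeRelBridge                       -- ★ `v_lt_one_iff_valuation_lt_one`, `v_eq_one_iff_valuation_eq_one`, `mem_glInt_iff_forall_v_le_one`
import Literature.NumberTheory.Automorphic.UnitriangularResidualRankStrata                   -- ★ L-α1: `rank_redMat_unitriangular_sub_one_eq_zero ∕ _one ∕ _two` (rank of `red [[1,a,b],[0,1,c],[0,0,1]] − 1` from `|a|, |b|, |c|`)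
import HarnessLib

/-!
# K2 ∕ E3 «EllipticInputs», unit U4 «Keys» — socket :155 (depth 0, Branch B), step Z3 (III): THE HAAR FACTS ON `N(L⁺_v)` BEHIND THE TWO CONSTANT ENTRIES —
# `N₀ = {n : n ∈ I}` and `N(𝔭) = {n : w₀ n w₀ ∈ I}` are Borel and compact, and `μ(N(𝔭)) = q⁻³ · μ(N₀)` for EVERY Haar measure `μ` on `N` (`v` inert)

Cell hodgecm-mathlib (D-0151), FLOOR 0, Track B «K2-LIT», engine E3, crux item H413 = stmt-HodgeConjecture-24833 (route `HCCMUnconditional`, no route verbs); target BY NAME the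
OPEN socket `…U4Keys.sig_K2E3KeysThmTwoContractingRamifiedCharOneDepthZeroNormTrivial` (:155; Keys §7 Thm. (2), ramified `χ₁` of depth 0 with `χ₁ ∘ N = 1` on units = BRANCH B of
design D-I v2 of K2E3-p06 (g4)), brick (III) of K2E3-p03 (g9)'s R0 census D171 (K2 bus 2026-09-04T16:17:51Z), taken by the S1 hand R90-C10-p04 (g0) (whose own socket S1#3 A2
`R90.S1.stub_R90_122_keys_trichotomy` «⇒» has exactly this leaf as residue).  `--supports stmt-HodgeConjecture-24833 --as helper`; THEOREMS ONLY (no `def`, no `instance`, no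
notation, no named-fact hypothesis, no `sorry`).  NOT THE PAYER.

THE FRAME is ★ `K2E3BranchBCasselmanPairConstants`' VERBATIM — `(w hw eA heA ϖ hϖ g₁ hg₁ K0 K1 I hK0 hK1 hI t ht w₀ hw₀)`, a measurable structure on `↥t.N` (here BOREL) and a measure
`μ` on it (here HAAR where needed).  For `n ∈ N(L⁺_v)` write `eA n = u(x, z)` (`z + σz + xσx = 0`, ★ `exists_coe_eA_eq_upper`).
* §1 **`measurableSet_setOf_coe_mem`**, **`measurableSet_setOf_conj_mem`** — `{n : n ∈ I}` and `{n : w₀ n w₀ ∈ I}` are OPEN in `N` (preimages of the open `I`, ★ `isOpen_isCompact_levels`,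
  under `N ↪ G` and `n ↦ w₀ n w₀`), hence Borel; **`isCompact_setOf_coe_mem`**, **`isCompact_setOf_conj_mem`** — and COMPACT (`N` is closed ★ `isClosed_N`, `I` compact, closed
  embeddings pull compact sets back to compact sets), hence of finite mass for every measure finite on compacts (**`measure_setOf_coe_mem_lt_top`**, **`measure_setOf_conj_mem_lt_top`**):
  the `hS ∕ hfin` binders of ★ `integral_toFun_weyl_mul_eq ∕ integrable_toFun_weyl_mul ∕ integral_toFun_conj_eq ∕ integrable_toFun_conj`, DISCHARGED.
* §2 **`setOf_coe_mem_eq_setOf_mem_integralLevel`** — `N ∩ I = N ∩ K_v` (`K_v = U(Φ₃)(𝒪_v)` ★ `cmLocalIntegralLevel`; `I ≤ K₀ = K_v` ★, and an integral `u(x, z)` has `|z|_w ≤ 1`, ★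
  `mem_iff_v_le_one`); **`setOf_conj_mem_eq_rankStratum_zero`** — `{n : w₀ n w₀ ∈ I} = S₀ := {n ∈ N ∩ K_v : rank(red(n_w) − 1) = 0}` (★ `conj_mem_iff_v_lt_one`: `w₀nw₀ ∈ I ⟺ |z|_w < 1`;
  and `red(u(x,z)_w) − 1 = [[0, x̄, z̄],[0, 0, −σx̄],[0,0,0]]` vanishes iff `|x|_w, |z|_w < 1`, where `|z|_w < 1 ⟹ |x|_w < 1` on `N`, ★ `v_lt_one_of_rel`) — ANY non-split `v`.
* §3 **`measureReal_setOf_conj_mem_eq`** — `μ.real {n : w₀ n w₀ ∈ I} = q⁻³ · μ.real {n : n ∈ I}`, `q = N𝔭_v`, for EVERY Haar measure `μ` on `N(L⁺_v)` at an UNRAMIFIED (inert)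
  `v` of ANY residue characteristic: §2 + ★ `measureReal_rankStratum_zero_anyChar` (the count `|N(𝔽_q)| = q³` of the finite Heisenberg group, done in the tree by the
  measure-preserving shear chart).  This is the ratio `vol N(𝔭) ∕ vol N₀ = q⁻³` of `PAPER-Z3-DepthZeroInert` §1 (`Λ_{w₀}(f₁) = q⁻³ · Λ_1(f_w)` after ★ Z3's two constant entries).

HONEST LABEL: HC_CM is proved only modulo the 7 printed citations (2 remaining named inputs: hLiu418 = stmt-HodgeConjecture-24832, h413 = stmt-HodgeConjecture-24833)
until rung 0 closes; count-neutral — this file does NOT pay the socket; no printed citation is discharged.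

## References
* [Rogawski1990] J. Rogawski, *Automorphic representations of unitary groups in three variables*, Ann. of Math. Stud. 123 (1990), §1.10 p. 9 (`N`, `u(x,z)`), §4.9 p. 54 (the strata of `N(𝒪)`).
* [Casselman1980] W. Casselman, *The unramified principal series of p-adic groups I*, Compositio Math. 40 (1980), §3 (the volumes `vol(N ∩ I)`, `vol(N ∩ w I w)` in the rank-one operators).
* [BruhatTits1972] F. Bruhat, J. Tits, *Groupes réductifs sur un corps local I*, Publ. Math. IHÉS 41 (1972), (4.4.4) (the Iwahori subgroup).
* [Flicker1998UnitaryFL] Y. Z. Flicker, *Elementary proof of the fundamental lemma for a unitary group*, Canad. J. Math. 50 (1998), §2 (`|N(𝔽_q)| = q³`).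
* [Keys1984] D. Keys, *Principal series representations of special unitary groups over local fields*, Compositio Math. 51 (1984), §7.
-/

set_option autoImplicit false
-- the mandated namespace has the single-problem summit's repeated segment (`HodgeConjecture.HodgeConjecture`)
set_option linter.dupNamespace false

noncomputable section

open NumberField IsDedekindDomain MeasureTheory Topology
open scoped Matrix MatrixGroups WithZero ValuativeRel
open Literature.NumberTheory Literature.NumberTheory.Automorphic Literature.NumberTheory.Automorphic.UnitaryGroup
open Literature.NumberTheory.Rogawski1990 Literature.NumberTheory.Automorphic.IntegralReduction

namespace Summit.HodgeConjecture.HodgeConjecture.Cruxes.H413.K2E3BranchBHaarFactsN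

open Summit.HodgeConjecture.HodgeConjecture.Cruxes.H413 Summit.HodgeConjecture.HodgeConjecture.Cruxes.H413.K2E3BranchBCellFunctionsCM
open Summit.HodgeConjecture.HodgeConjecture.Cruxes.H413.F0P3cStCharTSStLevelsTransport

/-! ## The frame (★ `K2E3BranchBCasselmanPairConstants`, verbatim) -/

variable (L : Type) [Field L] [NumberField L] [IsCMField L] (v : HeightOneSpectrum (𝓞 ↥(maximalRealSubfield L)))
  (w : PlacesOver L v) (hw : IsCMField.complexConj L • w.1 = w.1)
  (eA : Gqs L v ≃ₜ* ↥(unitaryGroupOfForm (galAdicCompletionMap (L := L) (IsCMField.complexConj L) hw) ((StdForm.antidiagonal 3).over (w.1.adicCompletion L))))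
  (heA : ∀ g : Gqs L v,
    ((eA g : ↥(unitaryGroupOfForm (galAdicCompletionMap (L := L) (IsCMField.complexConj L) hw) ((StdForm.antidiagonal 3).over (w.1.adicCompletion L)))) :
        GL (Fin 3) (w.1.adicCompletion L)) =
      ((localNonsplitEquiv (IsCMField.complexConj L) (qsForm L) (IsCMField.complexConj_ne_one L) w hw g :
        ↥(unitaryGroupOfForm (galAdicCompletionMap (L := L) (IsCMField.complexConj L) hw) (placeForm (qsForm L) w.1))) : GL (Fin 3) (w.1.adicCompletion L)))
  {ϖ : w.1.adicCompletion L} (hϖ : Valued.v ϖ = WithZero.exp (-1 : ℤ))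
  (g₁ : GL (Fin 3) (w.1.adicCompletion L)) (hg₁ : (g₁ : Matrix (Fin 3) (Fin 3) (w.1.adicCompletion L)) = Matrix.diagonal ![(1 : w.1.adicCompletion L), 1, ϖ])
  (K0 K1 I : Subgroup (Gqs L v))
  (hK0 : K0 = ((glInt 3 (w.1.adicCompletion L)).subgroupOf
    (unitaryGroupOfForm (galAdicCompletionMap (L := L) (IsCMField.complexConj L) hw) ((StdForm.antidiagonal 3).over (w.1.adicCompletion L)))).comap
      eA.toMulEquiv.toMonoidHom)
  (hK1 : K1 = (((glInt 3 (w.1.adicCompletion L)).map (MulAut.conj g₁).toMonoidHom).subgroupOf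
    (unitaryGroupOfForm (galAdicCompletionMap (L := L) (IsCMField.complexConj L) hw) ((StdForm.antidiagonal 3).over (w.1.adicCompletion L)))).comap
      eA.toMulEquiv.toMonoidHom)
  (hI : I = K0 ⊓ K1)
  (t : ParabolicTriple (Gqs L v)) (ht : t = cmBorelTriple L 3 v)
  (w₀ : Gqs L v) (hw₀ : Units.val (w₀.val : GL (Fin 3) (LocalRing L v)) = cmLocalForm L 3 v)

/-! ## §1 `N₀ = {n ∈ I}` and `N(𝔭) = {w₀ n w₀ ∈ I}` are open, compact, Borel, of finite mass -/

include hI hK0 hK1 in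
/-- **`{n ∈ N : n ∈ I}` is OPEN in `N`** (preimage of the open `I`, ★ `isOpen_isCompact_levels`, under the inclusion `N ↪ G`). [cite: BruhatTits1972, (4.4.4)] -/
theorem isOpen_setOf_coe_mem : IsOpen {m : ↥t.N | (m : Gqs L v) ∈ I} :=
  (isOpen_isCompact_levels L v w hw eA g₁ K0 K1 I hK0 hK1 hI).2.2.1.preimage continuous_subtype_val

include hI hK0 hK1 in
/-- **`{n ∈ N : w₀ n w₀ ∈ I}` is OPEN in `N`** (preimage of the open `I` under the continuous `n ↦ w₀ n w₀`). [cite: BruhatTits1972, (4.4.4)] -/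
theorem isOpen_setOf_conj_mem : IsOpen {m : ↥t.N | w₀ * (m : Gqs L v) * w₀ ∈ I} :=
  (isOpen_isCompact_levels L v w hw eA g₁ K0 K1 I hK0 hK1 hI).2.2.1.preimage
    ((continuous_const.mul continuous_subtype_val).mul continuous_const)

include hI hK0 hK1 in
/-- **`{n ∈ N : n ∈ I}` is a BOREL subset of `N`** — the binder `hS` of ★ `integral_toFun_weyl_mul_eq` ∕ `integrable_toFun_weyl_mul`, discharged. [cite: BruhatTits1972, (4.4.4)] -/
theorem measurableSet_setOf_coe_mem [MeasurableSpace ↥t.N] [BorelSpace ↥t.N] : MeasurableSet {m : ↥t.N | (m : Gqs L v) ∈ I} :=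
  (isOpen_setOf_coe_mem L v w hw eA g₁ K0 K1 I hK0 hK1 hI t).measurableSet

include hI hK0 hK1 in
/-- **`{n ∈ N : w₀ n w₀ ∈ I}` is a BOREL subset of `N`** — the binder `hS` of ★ `integral_toFun_conj_eq` ∕ `integrable_toFun_conj`, discharged. [cite: BruhatTits1972, (4.4.4)] -/
theorem measurableSet_setOf_conj_mem [MeasurableSpace ↥t.N] [BorelSpace ↥t.N] : MeasurableSet {m : ↥t.N | w₀ * (m : Gqs L v) * w₀ ∈ I} :=
  (isOpen_setOf_conj_mem L v w hw eA g₁ K0 K1 I hK0 hK1 hI t w₀).measurableSet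

include hI hK0 hK1 ht in
/-- **`{n ∈ N : n ∈ I}` is COMPACT** (`N` is closed in `G` ★ `isClosed_N`, so `N ↪ G` is a closed embedding; `I` is compact ★). [cite: BruhatTits1972, (4.4.4)] -/
theorem isCompact_setOf_coe_mem : IsCompact {m : ↥t.N | (m : Gqs L v) ∈ I} :=
  (K2E3BranchALettersCM.isClosed_N L v t ht).isClosedEmbedding_subtypeVal.isCompact_preimage
    (isOpen_isCompact_levels L v w hw eA g₁ K0 K1 I hK0 hK1 hI).2.2.2

include hI hK0 hK1 ht in
/-- **`{n ∈ N : w₀ n w₀ ∈ I}` is COMPACT** (`n ↦ w₀ n w₀` is the closed embedding `N ↪ G` followed by a homeomorphism of `G`). [cite: BruhatTits1972, (4.4.4)] -/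
theorem isCompact_setOf_conj_mem : IsCompact {m : ↥t.N | w₀ * (m : Gqs L v) * w₀ ∈ I} := by
  have hemb : Topology.IsClosedEmbedding (fun m : ↥t.N => w₀ * (m : Gqs L v) * w₀) :=
    ((Homeomorph.mulRight w₀).isClosedEmbedding.comp (Homeomorph.mulLeft w₀).isClosedEmbedding).comp
      (K2E3BranchALettersCM.isClosed_N L v t ht).isClosedEmbedding_subtypeVal
  exact hemb.isCompact_preimage (isOpen_isCompact_levels L v w hw eA g₁ K0 K1 I hK0 hK1 hI).2.2.2

include hI hK0 hK1 ht in
/-- **`μ {n ∈ N : n ∈ I} < ∞`** for every measure finite on compacts — the binder `hfin` of ★ `integrable_toFun_weyl_mul`, discharged. [cite: Casselman1980, §3] -/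
theorem measure_setOf_coe_mem_lt_top [MeasurableSpace ↥t.N] (μ : Measure ↥t.N) [IsFiniteMeasureOnCompacts μ] :
    μ {m : ↥t.N | (m : Gqs L v) ∈ I} < ⊤ :=
  (isCompact_setOf_coe_mem L v w hw eA g₁ K0 K1 I hK0 hK1 hI t ht).measure_lt_top

include hI hK0 hK1 ht in
/-- **`μ {n ∈ N : w₀ n w₀ ∈ I} < ∞`** for every measure finite on compacts — the binder `hfin` of ★ `integrable_toFun_conj`, discharged. [cite: Casselman1980, §3] -/
theorem measure_setOf_conj_mem_lt_top [MeasurableSpace ↥t.N] (μ : Measure ↥t.N) [IsFiniteMeasureOnCompacts μ] :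
    μ {m : ↥t.N | w₀ * (m : Gqs L v) * w₀ ∈ I} < ⊤ :=
  (isCompact_setOf_conj_mem L v w hw eA g₁ K0 K1 I hK0 hK1 hI t ht w₀).measure_lt_top

/-! ## §2 The two regions in the currency of ★ `HeisenbergStrataMeasure`: `N ∩ I = N ∩ K_v` and `{w₀ n w₀ ∈ I} = S₀` -/

include heA hϖ hg₁ hK0 hK1 hI ht in
/-- **`N ∩ I = N ∩ K_v`**: an element of `N(L⁺_v)` lies in the Iwahori `I` iff it lies in `K_v = U(Φ₃)(𝒪_v)` (★ `cmLocalIntegralLevel`): `I ≤ K₀ = K_v` (★ `I_le_K0`,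
★ `mem_K0_iff_mem_integralLevel`), and conversely `u(x, z) ∈ K₀` has integral entries, so `|z|_w ≤ 1`, so `u ∈ I` (★ `mem_iff_v_le_one`). [cite: BruhatTits1972, (4.4.4)]
[cite: Rogawski1990, §1.10 p. 9] -/
theorem setOf_coe_mem_eq_setOf_mem_integralLevel :
    {m : ↥t.N | (m : Gqs L v) ∈ I} = {m : ↥t.N | (m : Gqs L v) ∈ cmLocalIntegralLevel L 3 (qsForm L) v} := by
  ext m
  simp only [Set.mem_setOf_eq]
  constructor
  · exact fun hm => (mem_K0_iff_mem_integralLevel L v w hw eA heA K0 hK0 _).1 (I_le_K0 L v K0 K1 I hI hm)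
  · intro hm
    obtain ⟨x, z, hux, hrel⟩ := exists_coe_eA_eq_upper L v w hw eA heA t ht m.2
    have hK : (m : Gqs L v) ∈ K0 := (mem_K0_iff_mem_integralLevel L v w hw eA heA K0 hK0 _).2 hm
    have hgl : ((eA (m : Gqs L v) :
        ↥(unitaryGroupOfForm (galAdicCompletionMap (L := L) (IsCMField.complexConj L) hw) ((StdForm.antidiagonal 3).over (w.1.adicCompletion L)))) :
          GL (Fin 3) (w.1.adicCompletion L)) ∈ glInt 3 (w.1.adicCompletion L) := by
      rw [hK0, Subgroup.mem_comap, Subgroup.mem_subgroupOf] at hK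
      exact hK
    have hz : Valued.v z ≤ 1 := by
      have h := ((Literature.NumberTheory.Automorphic.mem_glInt_iff_forall_v_le_one _).1 hgl).1 0 2
      rw [hux] at h
      simpa using h
    exact (mem_iff_v_le_one L v w hw eA hϖ g₁ hg₁ K0 K1 I hK0 hK1 hI hux hrel).2 hz

include heA hϖ hg₁ hK0 hK1 hI ht hw₀ in
/-- **`{n ∈ N : w₀ n w₀ ∈ I} = S₀ = {n ∈ N ∩ K_v : rank(red(n_w) − 1) = 0}`** (ANY non-split `v`).  For `eA n = u(x, z)`: `w₀ n w₀ ∈ I ⟺ |z|_w < 1` (★ `conj_mem_iff_v_lt_one`);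
the matrix of `n` at `w` IS `u(x, z)` (★ `coe_eA_apply`), and `red(u(x, z)) − 1 = [[0, x̄, z̄], [0, 0, −σx̄], [0, 0, 0]]` is `0` iff `|x|_w, |z|_w < 1`, where on `N` already
`|z|_w < 1 ⟹ |x|_w < 1` (★ `v_lt_one_of_rel`); `n ∈ K_v` supplies `|z|_w ≤ 1` for the converse. [cite: Rogawski1990, §1.10 p. 9; §4.9 p. 54] [cite: BruhatTits1972, (4.4.4)] -/
theorem setOf_conj_mem_eq_rankStratum_zero :
    {m : ↥t.N | w₀ * (m : Gqs L v) * w₀ ∈ I} =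
      {m : ↥t.N | (m : Gqs L v) ∈ cmLocalIntegralLevel L 3 (qsForm L) v ∧
        (redMat (((m : Gqs L v).val.val : Matrix (Fin 3) (Fin 3) (LocalRing L v)).map
            (Pi.evalRingHom (fun w' : PlacesOver L v => w'.1.adicCompletion L) w)) - 1).rank = 0} := by
  ext m
  obtain ⟨x, z, hux, hrel⟩ := exists_coe_eA_eq_upper L v w hw eA heA t ht m.2
  have hvσ : ∀ y, Valued.v (galAdicCompletionMap (L := L) (IsCMField.complexConj L) hw y) = Valued.v y :=
    fun y => valued_galAdicCompletionMap (L := L) (IsCMField.complexConj L) hw y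
  -- the matrix of `m` at `w` is `eA m = u(x, z)`
  have hmap : ((m : Gqs L v).val.val : Matrix (Fin 3) (Fin 3) (LocalRing L v)).map
        (Pi.evalRingHom (fun w' : PlacesOver L v => w'.1.adicCompletion L) w) =
      !![1, x, z; 0, 1, -galAdicCompletionMap (L := L) (IsCMField.complexConj L) hw x; 0, 0, 1] := by
    rw [← hux]
    exact Matrix.ext fun i j => (coe_eA_apply L v w hw eA heA (m : Gqs L v) i j).symm
  have hmemI : Valued.v z ≤ 1 → (m : Gqs L v) ∈ cmLocalIntegralLevel L 3 (qsForm L) v := fun hz =>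
    (mem_K0_iff_mem_integralLevel L v w hw eA heA K0 hK0 _).1
      (I_le_K0 L v K0 K1 I hI ((mem_iff_v_le_one L v w hw eA hϖ g₁ hg₁ K0 K1 I hK0 hK1 hI hux hrel).2 hz))
  change w₀ * (m : Gqs L v) * w₀ ∈ I ↔
    (m : Gqs L v) ∈ cmLocalIntegralLevel L 3 (qsForm L) v ∧
      (redMat (((m : Gqs L v).val.val : Matrix (Fin 3) (Fin 3) (LocalRing L v)).map
          (Pi.evalRingHom (fun w' : PlacesOver L v => w'.1.adicCompletion L) w)) - 1).rank = 0
  rw [conj_mem_iff_v_lt_one L v w hw eA heA hϖ g₁ hg₁ K0 K1 I hK0 hK1 hI w₀ hw₀ hux hrel, hmap]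
  constructor
  · -- `|z|_w < 1` ⟹ `|x|_w < 1` on `N`, so all three off-diagonal residues vanish: rank `0` (★ L-α1)
    intro hz
    have hx : Valued.v x < 1 := K2E3BranchBCellGeometry.v_lt_one_of_rel _ hvσ hrel hz
    have hσx : Valued.v (-galAdicCompletionMap (L := L) (IsCMField.complexConj L) hw x) < 1 := by
      rw [Valuation.map_neg, hvσ]; exact hx
    exact ⟨hmemI hz.le, rank_redMat_unitriangular_sub_one_eq_zero ((v_lt_one_iff_valuation_lt_one _).1 hx)
      ((v_lt_one_iff_valuation_lt_one _).1 hz) ((v_lt_one_iff_valuation_lt_one _).1 hσx)⟩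
  · -- conversely `n ∈ K_v` makes `x, z` integral; `|x|_w = 1` would give rank `2`, `|x|_w < 1 = |z|_w` rank `1` (★ L-α1)
    rintro ⟨hK3, hrank⟩
    have hK : (m : Gqs L v) ∈ K0 := (mem_K0_iff_mem_integralLevel L v w hw eA heA K0 hK0 _).2 hK3
    have hgl : ((eA (m : Gqs L v) :
        ↥(unitaryGroupOfForm (galAdicCompletionMap (L := L) (IsCMField.complexConj L) hw) ((StdForm.antidiagonal 3).over (w.1.adicCompletion L)))) :
          GL (Fin 3) (w.1.adicCompletion L)) ∈ glInt 3 (w.1.adicCompletion L) := by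
      rw [hK0, Subgroup.mem_comap, Subgroup.mem_subgroupOf] at hK
      exact hK
    have hall := ((Literature.NumberTheory.Automorphic.mem_glInt_iff_forall_v_le_one _).1 hgl).1
    have hx1 : Valued.v x ≤ 1 := by
      have h := hall 0 1
      rw [hux] at h
      simpa using h
    have hz1 : Valued.v z ≤ 1 := by
      have h := hall 0 2
      rw [hux] at h
      simpa using h
    rcases hx1.lt_or_eq with hx | hx
    · rcases hz1.lt_or_eq with hz | hz
      · exact hz
      · exfalso
        have hσx : Valued.v (-galAdicCompletionMap (L := L) (IsCMField.complexConj L) hw x) < 1 := by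
          rw [Valuation.map_neg, hvσ]; exact hx
        rw [rank_redMat_unitriangular_sub_one_eq_one ((v_lt_one_iff_valuation_lt_one _).1 hx)
          ((v_eq_one_iff_valuation_eq_one _).1 hz) ((v_lt_one_iff_valuation_lt_one _).1 hσx)] at hrank
        exact one_ne_zero hrank
    · exfalso
      have hσx : Valued.v (-galAdicCompletionMap (L := L) (IsCMField.complexConj L) hw x) = 1 := by
        rw [Valuation.map_neg, hvσ]; exact hx
      rw [rank_redMat_unitriangular_sub_one_eq_two (b := z) ((v_eq_one_iff_valuation_eq_one _).1 hx)
        ((v_eq_one_iff_valuation_eq_one _).1 hσx)] at hrank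
      exact two_ne_zero hrank

/-! ## §3 `μ(N(𝔭)) = q⁻³ · μ(N₀)` for every Haar measure on `N(L⁺_v)`, `v` unramified -/

include hw heA hϖ hg₁ hK0 hK1 hI ht hw₀ in
/-- **`μ.real {n : w₀ n w₀ ∈ I} = q⁻³ · μ.real {n : n ∈ I}`**, `q = N𝔭_v`, for EVERY Haar measure `μ` on `N(L⁺_v)`, at a non-split place `v` UNRAMIFIED in `L` (any residue
characteristic): §2 turns both sets into the currency of ★ `measureReal_rankStratum_zero_anyChar` (`μ_N(S₀) = q⁻³ · μ_N(N ∩ K₃)` — the proportion `1 ∕ q³` of the identity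
in the finite Heisenberg group `N(𝔽_q)`, via the measure-preserving shear chart).  This is `vol N(𝔭) ∕ vol N₀ = q⁻³` of `PAPER-Z3-DepthZeroInert` §1, i.e. with ★ Z3's constant
entries `Λ_{w₀}(f₁) = q⁻³ · Λ_1(f_w)` for the normalised type basis. [cite: Rogawski1990, §4.9 p. 54] [cite: Casselman1980, §3] [cite: Flicker1998UnitaryFL, §2] -/
theorem measureReal_setOf_conj_mem_eq [instM : MeasurableSpace ↥t.N] [instB : BorelSpace ↥t.N] (μ : Measure ↥t.N) [instH : μ.IsHaarMeasure]
    (hunr : Algebra.IsUnramifiedIn (𝓞 L) v.asIdeal) :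
    μ.real {m : ↥t.N | w₀ * (m : Gqs L v) * w₀ ∈ I} = ((Ideal.absNorm v.asIdeal : ℝ) ^ 3)⁻¹ * μ.real {m : ↥t.N | (m : Gqs L v) ∈ I} := by
  rw [setOf_conj_mem_eq_rankStratum_zero L v w hw eA heA hϖ g₁ hg₁ K0 K1 I hK0 hK1 hI t ht w₀ hw₀,
    setOf_coe_mem_eq_setOf_mem_integralLevel L v w hw eA heA hϖ g₁ hg₁ K0 K1 I hK0 hK1 hI t ht]
  subst ht
  -- `subst` drops the local-instance registration of `instM ∕ instB ∕ instH`; hand them over explicitly (the carriers agree by `rfl`)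
  exact @measureReal_rankStratum_zero_anyChar L _ _ _ v w hw instM instB μ instH hunr

end Summit.HodgeConjecture.HodgeConjecture.Cruxes.H413.K2E3BranchBHaarFactsN

end
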